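import Mathlib.Algebra.Order.Archimedean.Real.Basic
import Mathlib.Algebra.Order.Floor.Ring
import Mathlib.Data.Int.Interval
import Mathlib.Tactic
import HarnessLib

/-!
# Navigating the infrastructure to a prescribed distance (Jozsa 2003, Thm. 5), with honest precision

Topic `Computability/Cryptography`; brick of the discharge of
`Literature.Computability.Cryptography.Hallgren2007_regulator_qsolvable_delim` (`HallgrenPell.lean`),
companion of `HallgrenCombTable.lean` (`BlurredGapTable`). Theorem-and-definition file, no named
facts; the arithmetic of reduced ideals is abstracted away (structures `WalkData` — the operations
the program uses — and `GiantStepCycle` — the true distances and the accuracy axioms), so that this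
file is pure bookkeeping of rational approximations.

Jozsa 2003, §9, Thm. 5 ("The function `h` is computable in polynomial time"): starting from
`𝒪`, iterated `*`-squaring `I_{k+1} = I_k * I_k` doubles the distance up to `½ ln D`
(op. cit. Prop. 35), a greedy descent "continue moving towards `x` from the left in successively
smaller steps … ensuring each time to stay to the left of `x`" reaches a reduced ideal within
`O(log D · log x)` of `x`, and finally "we repeatedly apply `ρ` … If `J'` is the last such ideal to
the left of `x` then `I_x` will certainly be either `J'` or `ρ(J')`", while "we also carry along a
parallel computation of their accumulating distances … to a sufficient accuracy". The print treats
the distances as exact reals. Here every distance is a RATIONAL approximation: the baby step adds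
`ghat a ≈ ln γ(a)` and the giant step adds `khat a b ≈ κ(a, b)` (the defect of op. cit. Prop. 33 /
Jacobson–Williams (7.28): `δ(a * b) = δ(a) + δ(b) + κ`), each within `η` of the truth, and all
comparisons are made on the approximations. We prove:

* `approx_final` — every state `(a, d̂)` the walk produces is an ideal label together with a
  rational within an explicit `E_tot = (2^{T+1}(s₀ + 1) + B) η` of one of the true unrolled
  distances of that ideal (`Approx`);
* `final_le`, `lt_final_baby` — the walk to the target `x` ends at a state `J` with
  `d̂(J) ≤ x < d̂(ρ J)` (the descent leaves a residual `≤ Res = O(T · K)`, `residual_descent_le`,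
  which `B ≥ 2 Res/(L − 2η) + 3` baby steps exhaust, two consecutive gaps being `≥ L = ln 2`);
* **`final_eq_of_generic`** — two targets `x, x'` in the same stretch between consecutive true
  positions, both farther than `E_tot + η` from every true position, lead to the SAME final state:
  every comparison is between the target and an `E_tot`-approximation of a true position, so the
  two runs take identical decisions (this is what makes the computed table canonical on generic
  grid points, `HallgrenCombTable.lean`);
* `final_correct` — at such a generic target the final label IS the ideal to the left of `x` and
  `d̂` is within `E_tot` of ITS position (not merely of some copy).

The table `v ↦ (label, v − ⌈N d̂⌉)` of the walk to `x = v/N` (`table`) is then a blurred gap table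
in the sense of `HallgrenCombTable.lean` (blur radius `N E_tot`, anchor tolerance `N E_tot + 1`,
anchors `⌈N d̂⌉` shared by all generic grid points of a stretch); that packaging is `table_blur`,
`table_exact`, `final_eq_of_generic_grid` below, stated without the structure so that this file
does not depend on it. Adequate parameters: `le_start` (start-up rounds `s₀`), `le_dbl_of_le_two_pow`
(doubling depth `T`), `lt_final_babyStep` (final rounds `B = 2M`, `M(L − 2η) > Res`, `Res_le`),
`Etot_le` (precision).

## References

* R. Jozsa, *Notes on Hallgren's efficient quantum algorithm for solving Pell's equation*,
  arXiv:quant-ph/0302134 (2003), §7.1 Prop. 35, §9 Thm. 5, §10 Prop. 36. [Jozsa2003]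
* M. J. Jacobson, Jr., H. C. Williams, *Solving the Pell Equation*, Springer (2009), §7.4,
  eq. (7.28) and the giant step `*`; §11 (approximate distances). [JacobsonWilliams2008]
-/

noncomputable section

open Finset

namespace Literature.Computability.Cryptography

/-- **The data a walk in the infrastructure computes with** (no axioms): the unit ideal, the baby
step `ρ`, the giant step `*`, rational evaluators of the gap after an ideal and of the defect of a
giant step, and a rational bound `K` on the defects. The programs below (`start`, `dbl`, `descent`,
`final`, `table`) are written on this data alone, so that their polynomial-time implementation can
be stated uniformly in the instance; `GiantStepCycle` adds the true distances and the accuracy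
axioms. [cite: Jozsa2003, §9 (proof of Thm. 5)] -/
structure WalkData (ι : Type*) where
  /-- the unit ideal `𝒪` -/
  unit : ι
  /-- baby step -/
  rho : ι → ι
  /-- giant step -/
  star : ι → ι → ι
  /-- computed gap after an ideal -/
  ghat : ι → ℚ
  /-- computed defect of the giant step -/
  khat : ι → ι → ℚ
  /-- a rational bound on the defects, available to the program -/
  K : ℚ

namespace WalkData

variable {ι : Type*} (W : WalkData ι)

/-- A state of the walk: an ideal label with its computed (unrolled, rational) distance.
[cite: Jozsa2003, §9 (proof of Thm. 5: "a parallel computation of their accumulating distances")] -/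
abbrev St (ι : Type*) := ι × ℚ

/-- The baby step `ρ` with its computed distance increment. [cite: Jozsa2003, §9 (δ(I, ρ(I)) = ln γ)] -/
def babyStep (s : St ι) : St ι := (W.rho s.1, s.2 + W.ghat s.1)

/-- The giant step `*` with its computed distance. [cite: Jozsa2003, §7.1 (I * I), §9] -/
def giantStep (s t : St ι) : St ι := (W.star s.1 t.1, s.2 + t.2 + W.khat s.1 t.1)

/-- One round of the start-up: advance by `ρ` while the computed distance is `< 2K + 1`.
[cite: Jozsa2003, §9 (proof of Thm. 5: "Apply ρ twice to get I₀")] -/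
def startStep (s : St ι) : St ι := if s.2 < 2 * W.K + 1 then W.babyStep s else s

/-- The start-up state after `s₀` rounds from the unit ideal. [cite: Jozsa2003, §9 (proof of Thm. 5)] -/
def start (s₀ : ℕ) : St ι := (W.startStep)^[s₀] (W.unit, 0)

/-- The doubling sequence `I_0 = start`, `I_{k+1} = I_k * I_k`, with computed distances.
[cite: Jozsa2003, §7.1 Prop. 35, §9 (proof of Thm. 5)] -/
def dbl (s₀ : ℕ) : ℕ → St ι
  | 0 => W.start s₀
  | k + 1 => W.giantStep (dbl s₀ k) (dbl s₀ k)

/-- One level of the descent towards `x`: try the giant step by `I_k`, keep it if it stays at or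
to the left of `x`. [cite: Jozsa2003, §9 (proof of Thm. 5: "replace J by J * I_k so long as δ(J * I_k) < x")] -/
def descStep (x : ℚ) (s₀ : ℕ) (J : St ι) (k : ℕ) : St ι :=
  if (W.giantStep J (W.dbl s₀ k)).2 ≤ x then W.giantStep J (W.dbl s₀ k) else J

/-- The descent from the unit ideal through the levels `T − 1, …, k` (the levels `≥ k`
processed, highest first). [cite: Jozsa2003, §9 (proof of Thm. 5)] -/
def descentFrom (x : ℚ) (s₀ T : ℕ) (k : ℕ) : St ι :=
  ((List.range' k (T - k)).reverse).foldl (W.descStep x s₀) (W.unit, 0)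

/-- The full descent (all levels `T − 1, …, 0`). [cite: Jozsa2003, §9 (proof of Thm. 5)] -/
def descent (x : ℚ) (s₀ T : ℕ) : St ι := W.descentFrom x s₀ T 0

/-- One round of the final walk: advance by `ρ` if that stays at or to the left of `x`.
[cite: Jozsa2003, §9 (proof of Thm. 5: "we repeatedly apply ρ … until the distance again exceeds x")] -/
def finStep (x : ℚ) (J : St ι) : St ι := if (W.babyStep J).2 ≤ x then W.babyStep J else J

/-- **The walk to `x`**: start-up of `s₀` rounds, `T` doubling levels, descent, `B` final rounds.
[cite: Jozsa2003, §9 Thm. 5] -/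
def final (x : ℚ) (s₀ T B : ℕ) : St ι := (W.finStep x)^[B] (W.descent x s₀ T)

/-- **The computed table** on the grid of mesh `1/N`: walk to `x = v/N` and output the final label
with the integer offset `v − ⌈N d̂⌉` (`= ⌊N (x − d̂)⌋`, Jozsa's rounded distance gap).
[cite: Jozsa2003, §10 (h̃_N(k) = (I_{k/N}, ⌊k/N − δ(I_{k/N})⌋_N))] -/
def table (N s₀ T B : ℕ) (v : ℤ) : ι × ℤ :=
  ((W.final ((v : ℚ) / N) s₀ T B).1, v - ⌈(N : ℚ) * (W.final ((v : ℚ) / N) s₀ T B).2⌉)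

end WalkData

open WalkData

/-- **An abstract infrastructure with approximate distance evaluators** (the principal cycle of a
real quadratic order as used by Hallgren's algorithm; Jozsa 2003 §6–§7, Jacobson–Williams §7.4):
`n` ideals per period `R` at unrolled true distances `P : ℤ → ℝ` (`P 0 = 0`, strictly increasing,
`P (m + n) = P m + R`) with labels `lab` (equal iff indices agree mod `n`, `lab 0 = unit`); on top
of the `WalkData` — the baby step `rho` (`ρ`, one ideal further), the giant step `star` (`*`) — its
distance defect `kappa`,
`|kappa| ≤ K` (`δ(a * b) ≡ δ(a) + δ(b) + κ`, op. cit. (7.28) / Jozsa Prop. 33), rational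
evaluators `ghat ≈` the gap after an ideal and `khat ≈ kappa`, both to precision `η ≤ 1/8`, gaps
`≤ G`, and two consecutive gaps `≥ L > 2η` (Jozsa Props. 31–32: `½ ln D` and `ln 2`).
[cite: Jozsa2003, §7 Props. 31–33, §7.1 Prop. 35] [cite: JacobsonWilliams2008, §7.4 eq. (7.28)] -/
structure GiantStepCycle (ι : Type*) extends WalkData ι where
  /-- the circumference (regulator) -/
  R : ℝ
  /-- the number of ideals on the cycle -/
  n : ℕ
  /-- unrolled true distances -/
  P : ℤ → ℝ
  /-- the ideal at unrolled index `m` -/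
  lab : ℤ → ι
  /-- true distance defect of the giant step -/
  kappa : ι → ι → ℝ
  /-- precision of the evaluators -/
  η : ℝ
  /-- maximal gap -/
  G : ℝ
  /-- minimal double gap -/
  L : ℝ
  /-- at least one ideal -/
  n_pos : 0 < n
  /-- distances increase -/
  strictMono : StrictMono P
  /-- the unit ideal sits at distance `0` -/
  P_zero : P 0 = 0
  /-- the unit ideal is the label of index `0` -/
  lab_zero : lab 0 = unit
  /-- one period further is `R` further -/
  periodic : ∀ m, P (m + n) = P m + R
  /-- labels name ideals -/
  lab_eq_iff : ∀ m m', lab m = lab m' ↔ (n : ℤ) ∣ m - m'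
  /-- the baby step moves to the next ideal -/
  rho_lab : ∀ m, rho (lab m) = lab (m + 1)
  /-- the giant step lands on the cycle, at the sum of the distances plus the defect -/
  star_lab : ∀ m₁ m₂, ∃ m, lab m = star (lab m₁) (lab m₂) ∧
    P m = P m₁ + P m₂ + kappa (lab m₁) (lab m₂)
  /-- defects are bounded -/
  abs_kappa_le : ∀ a b, |kappa a b| ≤ K
  /-- the gap evaluator is `η`-accurate -/
  ghat_spec : ∀ m, |(ghat (lab m) : ℝ) - (P (m + 1) - P m)| ≤ η
  /-- the defect evaluator is `η`-accurate -/
  khat_spec : ∀ a b, |(khat a b : ℝ) - kappa a b| ≤ η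
  /-- precision is nonnegative -/
  η_nonneg : 0 ≤ η
  /-- precision is at most `1/8` -/
  η_le : η ≤ 1 / 8
  /-- gaps are at most `G` -/
  gap_le : ∀ m, P (m + 1) - P m ≤ G
  /-- double gaps are at least `L` -/
  two_gap : ∀ m, L ≤ P (m + 2) - P m
  /-- `L` beats the precision -/
  L_gt : 2 * η < L

namespace GiantStepCycle

open WalkData

variable {ι : Type*} (C : GiantStepCycle ι)

/-! ### Basic consequences -/

/-- `K ≥ 0`. [folklore] -/
theorem K_nonneg : (0 : ℝ) ≤ C.K := (abs_nonneg _).trans (C.abs_kappa_le (C.lab 0) (C.lab 0))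

/-- `L > 0`. [folklore] -/
theorem L_pos : 0 < C.L := by have := C.L_gt; have := C.η_nonneg; linarith

/-- Gaps are positive. [folklore] -/
theorem gap_pos (m : ℤ) : 0 < C.P (m + 1) - C.P m := by
  have := C.strictMono (show m < m + 1 by omega); linarith

/-- `G > 0`. [folklore] -/
theorem G_pos : 0 < C.G := lt_of_lt_of_le (C.gap_pos 0) (C.gap_le 0)

/-- `P (m + l n) = P m + l R`. [folklore] -/
theorem P_add_mul (m l : ℤ) : C.P (m + l * C.n) = C.P m + l * C.R := by
  induction l using Int.induction_on with
  | zero => simp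
  | succ i ih =>
    have := C.periodic (m + i * C.n)
    rw [show m + (i + 1) * C.n = m + i * C.n + C.n by ring, this, ih]
    push_cast; ring
  | pred i ih =>
    have := C.periodic (m + (-(i : ℤ) - 1) * C.n)
    rw [show m + (-(i : ℤ) - 1) * C.n + C.n = m + -(i : ℤ) * C.n by ring] at this
    rw [ih] at this
    push_cast at this ⊢
    linarith

/-- Labels are `n`-periodic. [folklore] -/
theorem lab_add_mul (m l : ℤ) : C.lab (m + l * C.n) = C.lab m :=
  (C.lab_eq_iff _ _).mpr ⟨l, by ring⟩

/-- Equal labels differ by a multiple of `n`. [folklore] -/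
theorem exists_eq_add_mul_of_lab_eq {m m' : ℤ} (h : C.lab m = C.lab m') :
    ∃ l : ℤ, m = m' + l * C.n := by
  obtain ⟨l, hl⟩ := (C.lab_eq_iff _ _).mp h
  exact ⟨l, by linarith⟩

/-- The gap after an ideal depends only on its label. [folklore] -/
theorem gap_eq_of_lab_eq {m m' : ℤ} (h : C.lab m = C.lab m') :
    C.P (m + 1) - C.P m = C.P (m' + 1) - C.P m' := by
  obtain ⟨l, rfl⟩ := C.exists_eq_add_mul_of_lab_eq h
  rw [show m' + l * C.n + 1 = (m' + 1) + l * C.n by ring, C.P_add_mul, C.P_add_mul]; ring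

/-! ### States, baby steps and giant steps with rational distances -/


/-- **Approximate states**: `(a, d̂)` is `E`-approximate if `a` is the ideal at some unrolled index
`m` and `d̂` is within `E` of the true distance `P m`. [cite: Jozsa2003, §9 Thm. 5 (accuracy of the distances)] -/
def Approx (s : St ι) (E : ℝ) : Prop := ∃ m, C.lab m = s.1 ∧ |(s.2 : ℝ) - C.P m| ≤ E

/-- The unit ideal at distance `0` is exact. [folklore] -/
theorem approx_unit : C.Approx (C.unit, 0) 0 := ⟨0, C.lab_zero, by simp [C.P_zero]⟩

variable {C} in
/-- Monotonicity of `Approx` in the error. [folklore] -/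
theorem Approx.mono {s : St ι} {E E' : ℝ} (h : C.Approx s E) (hE : E ≤ E') : C.Approx s E' := by
  obtain ⟨m, hm, hs⟩ := h; exact ⟨m, hm, hs.trans hE⟩

/-- **A baby step costs `η`.** [cite: Jozsa2003, §9 Thm. 5] -/
theorem approx_babyStep {s : St ι} {E : ℝ} (h : C.Approx s E) : C.Approx (C.babyStep s) (E + C.η) := by
  obtain ⟨m, hm, hs⟩ := h
  refine ⟨m + 1, by rw [← C.rho_lab, hm]; rfl, ?_⟩
  have hg := C.ghat_spec m
  rw [hm] at hg
  simp only [babyStep, Rat.cast_add]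
  rw [abs_le] at hs hg ⊢
  constructor <;> linarith [hs.1, hs.2, hg.1, hg.2]

/-- **A giant step costs `η`.** [cite: Jozsa2003, §7.1 Prop. 35, §9 Thm. 5] -/
theorem approx_giantStep {s t : St ι} {E₁ E₂ : ℝ} (hs : C.Approx s E₁) (ht : C.Approx t E₂) :
    C.Approx (C.giantStep s t) (E₁ + E₂ + C.η) := by
  obtain ⟨m₁, hm₁, hs⟩ := hs
  obtain ⟨m₂, hm₂, ht⟩ := ht
  obtain ⟨m, hm, hP⟩ := C.star_lab m₁ m₂
  refine ⟨m, by rw [hm, hm₁, hm₂]; rfl, ?_⟩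
  have hk := C.khat_spec (C.lab m₁) (C.lab m₂)
  rw [hm₁, hm₂] at hk
  simp only [giantStep, Rat.cast_add]
  rw [hP, hm₁, hm₂]
  rw [abs_le] at hs ht hk ⊢
  constructor <;> linarith [hs.1, hs.2, ht.1, ht.2, hk.1, hk.2]

/-- An approximate state two baby steps on has advanced by at least `L − 2η` minus `2E`… more
usefully: the computed distance advances by at least `L − 2η` over two baby steps. [cite: Jozsa2003, Prop. 32 (δ(J, ρ²J) ≥ ln 2)] -/
theorem two_babySteps_ge {s : St ι} {E : ℝ} (h : C.Approx s E) :
    (s.2 : ℝ) + (C.L - 2 * C.η) ≤ ((C.babyStep (C.babyStep s)).2 : ℝ) := by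
  obtain ⟨m, hm, _⟩ := h
  have hg₁ := C.ghat_spec m
  have hg₂ := C.ghat_spec (m + 1)
  rw [hm] at hg₁
  rw [← C.rho_lab, hm] at hg₂
  have h2 := C.two_gap m
  simp only [babyStep, Rat.cast_add]
  rw [abs_le] at hg₁ hg₂
  rw [show m + 1 + 1 = m + 2 by ring] at hg₂
  linarith [hg₁.1, hg₂.1]

/-- One baby step advances the computed distance by at most `G + η` (and at least `−η`). [cite: Jozsa2003, Prop. 31 (δ(J, ρJ) ≤ ½ ln D)] -/
theorem babyStep_le {s : St ι} {E : ℝ} (h : C.Approx s E) :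
    ((C.babyStep s).2 : ℝ) ≤ s.2 + (C.G + C.η) ∧ (s.2 : ℝ) - C.η ≤ (C.babyStep s).2 := by
  obtain ⟨m, hm, _⟩ := h
  have hg := C.ghat_spec m
  rw [hm] at hg
  have h1 := C.gap_le m
  have h0 := C.gap_pos m
  simp only [babyStep, Rat.cast_add]
  rw [abs_le] at hg
  constructor <;> linarith [hg.1, hg.2]

/-- The computed defect is at most `K + η` in absolute value. [folklore] -/
theorem abs_khat_le (a b : ι) : |(C.khat a b : ℝ)| ≤ C.K + C.η := by
  have h1 := C.khat_spec a b
  have h2 := C.abs_kappa_le a b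
  calc |(C.khat a b : ℝ)| = |((C.khat a b : ℝ) - C.kappa a b) + C.kappa a b| := by ring_nf
    _ ≤ |(C.khat a b : ℝ) - C.kappa a b| + |C.kappa a b| := abs_add_le _ _
    _ ≤ C.η + C.K := add_le_add h1 h2
    _ = C.K + C.η := add_comm _ _

/-! ### Phase 0: a first ideal beyond `2K + 1` by baby steps -/

/-- A frozen start-up state stays frozen. [folklore] -/
theorem startStep_of_le {s : St ι} (h : 2 * C.K + 1 ≤ s.2) : C.startStep s = s := by
  simp [startStep, not_lt.mpr h]

/-- The start-up states are `j η`-approximate after `j` rounds. [folklore] -/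
theorem approx_start (j : ℕ) : C.Approx (C.start j) (j * C.η) := by
  induction j with
  | zero => simpa [start] using C.approx_unit
  | succ j ih =>
    rw [start, Function.iterate_succ_apply', ← start]
    unfold startStep
    split_ifs
    · have := C.approx_babyStep ih; push_cast; simpa [add_mul] using this
    · have hle : (j : ℝ) * C.η ≤ ((j + 1 : ℕ) : ℝ) * C.η := by push_cast; nlinarith [C.η_nonneg]
      exact ih.mono hle

/-- While not frozen, `2j` start-up rounds advance the computed distance by at least `j (L − 2η)`.
[cite: Jozsa2003, Prop. 32] -/
theorem start_ge_of_lt (j : ℕ) (h : ∀ i < 2 * j, (C.start i).2 < 2 * C.K + 1) :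
    (j : ℝ) * (C.L - 2 * C.η) ≤ ((C.start (2 * j)).2 : ℝ) := by
  induction j with
  | zero => simp [start]
  | succ j ih =>
    have h' : ∀ i < 2 * j, (C.start i).2 < 2 * C.K + 1 := fun i hi => h i (by omega)
    have ih' := ih h'
    have h1 : C.start (2 * j + 1) = C.babyStep (C.start (2 * j)) := by
      rw [start, Function.iterate_succ_apply', ← start, startStep, if_pos (h _ (by omega))]
    have h2 : C.start (2 * (j + 1)) = C.babyStep (C.start (2 * j + 1)) := by
      rw [show 2 * (j + 1) = (2 * j + 1) + 1 by ring, start, Function.iterate_succ_apply', ← start,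
        startStep, if_pos (h _ (by omega))]
    rw [h2, h1]
    have := C.two_babySteps_ge (C.approx_start (2 * j))
    push_cast
    linarith

/-- **The start-up freezes**: whenever `2K + 1 ≤ j (L − 2η)` and `2j ≤ s₀`, the start-up state has
computed distance `≥ 2K + 1`. [cite: Jozsa2003, §9 (proof of Thm. 5)] -/
theorem le_start {j s₀ : ℕ} (hj : (2 * C.K + 1 : ℝ) ≤ j * (C.L - 2 * C.η)) (hs : 2 * j ≤ s₀) :
    2 * C.K + 1 ≤ (C.start s₀).2 := by
  -- some round `i ≤ 2j` is frozen, and frozen states persist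
  by_contra hcon
  push Not at hcon
  have hpersist : ∀ i i', i ≤ i' → 2 * C.K + 1 ≤ (C.start i).2 → 2 * C.K + 1 ≤ (C.start i').2 := by
    intro i i' hii' hi
    induction i' with
    | zero =>
      have : i = 0 := by omega
      subst this; exact hi
    | succ i' ih =>
      rcases Nat.eq_or_lt_of_le hii' with h | h
      · rw [← h]; exact hi
      · have := ih (by omega)
        rw [start, Function.iterate_succ_apply', ← start, C.startStep_of_le this]; exact this
  have hall : ∀ i < 2 * j, (C.start i).2 < 2 * C.K + 1 := by
    intro i hi
    by_contra hc
    push Not at hc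
    exact absurd (hpersist i s₀ (by omega) hc) (not_le.mpr hcon)
  have hge := C.start_ge_of_lt j hall
  have hlt : (C.start (2 * j)).2 < 2 * C.K + 1 := by
    by_contra hc; push Not at hc
    exact absurd (hpersist _ s₀ hs hc) (not_le.mpr hcon)
  have : ((C.start (2 * j)).2 : ℝ) < 2 * C.K + 1 := by exact_mod_cast hlt
  linarith

/-- The start-up state is at most `2K + 1 + G + η` (it froze at the first excess). [folklore] -/
theorem start_le (s₀ : ℕ) : ((C.start s₀).2 : ℝ) ≤ 2 * C.K + 1 + (C.G + C.η) := by
  induction s₀ with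
  | zero => simp [start]; have := C.K_nonneg; have := C.G_pos; have := C.η_nonneg; linarith
  | succ j ih =>
    rw [start, Function.iterate_succ_apply', ← start]
    unfold startStep
    split_ifs with h
    · have h1 := (C.babyStep_le (C.approx_start j)).1
      have : ((C.start j).2 : ℝ) < 2 * C.K + 1 := by exact_mod_cast h
      linarith
    · exact ih

/-! ### Phase A: iterated `*`-squaring -/

/-- Error of the doubling sequence: `E_k = 2^k (s₀ + 1) η − η` (so `E_{k+1} = 2 E_k + η`). [folklore] -/
def Edbl (s₀ k : ℕ) : ℝ := 2 ^ k * ((s₀ : ℝ) + 1) * C.η - C.η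

/-- `E_0 = s₀ η`. [folklore] -/
theorem Edbl_zero (s₀ : ℕ) : C.Edbl s₀ 0 = s₀ * C.η := by simp [Edbl]; ring

/-- `E_{k+1} = 2E_k + η`. [folklore] -/
theorem Edbl_succ (s₀ k : ℕ) : C.Edbl s₀ (k + 1) = 2 * C.Edbl s₀ k + C.η := by
  simp [Edbl, pow_succ]; ring

/-- `E_k ≥ 0`. [folklore] -/
theorem Edbl_nonneg (s₀ k : ℕ) : 0 ≤ C.Edbl s₀ k := by
  have hη := C.η_nonneg
  unfold Edbl
  have : (1 : ℝ) ≤ 2 ^ k * ((s₀ : ℝ) + 1) := by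
    have h1 : (1 : ℝ) ≤ 2 ^ k := one_le_pow₀ (by norm_num)
    have h2 : (1 : ℝ) ≤ (s₀ : ℝ) + 1 := by
      have : (0 : ℝ) ≤ s₀ := by positivity
      linarith
    nlinarith
  nlinarith

/-- `E_k ≤ 2^k (s₀ + 1) η`. [folklore] -/
theorem Edbl_le (s₀ k : ℕ) : C.Edbl s₀ k ≤ 2 ^ k * ((s₀ : ℝ) + 1) * C.η := by
  have := C.η_nonneg; unfold Edbl; linarith

/-- **The doubling sequence is `E_k`-approximate.** [cite: Jozsa2003, §7.1 Prop. 35] -/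
theorem approx_dbl (s₀ k : ℕ) : C.Approx (C.dbl s₀ k) (C.Edbl s₀ k) := by
  induction k with
  | zero => rw [Edbl_zero]; exact C.approx_start s₀
  | succ k ih =>
    rw [Edbl_succ]
    have := C.approx_giantStep ih ih
    simpa [dbl, two_mul] using this

/-- **The doubling sequence at least doubles, up to the defect**: with `d̂(I_0) ≥ 2K + 1`,
`d̂(I_k) ≥ 2^k · 7/8 + (K + 1/8)`. [cite: Jozsa2003, §7.1 Prop. 35 (δ(I^{(2^n)}) > 2^n δ(I))] -/
theorem dbl_ge {s₀ : ℕ} (h0 : 2 * C.K + 1 ≤ (C.start s₀).2) (k : ℕ) :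
    (2 : ℝ) ^ k * (7 / 8) + (C.K + 1 / 8) ≤ ((C.dbl s₀ k).2 : ℝ) := by
  induction k with
  | zero =>
    have : (2 * C.K + 1 : ℝ) ≤ ((C.start s₀).2 : ℝ) := by exact_mod_cast h0
    have hK := C.K_nonneg
    simp [dbl]; linarith
  | succ k ih =>
    have hk := C.abs_khat_le (C.dbl s₀ k).1 (C.dbl s₀ k).1
    have hη := C.η_le
    simp only [dbl, giantStep, Rat.cast_add]
    rw [abs_le] at hk
    rw [pow_succ]
    linarith [hk.1]

/-- Consecutive doubling distances: `d̂(I_{k+1}) ≤ 2 d̂(I_k) + K + η`. [folklore] -/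
theorem dbl_succ_le (s₀ k : ℕ) :
    ((C.dbl s₀ (k + 1)).2 : ℝ) ≤ 2 * (C.dbl s₀ k).2 + (C.K + C.η) := by
  have hk := C.abs_khat_le (C.dbl s₀ k).1 (C.dbl s₀ k).1
  simp only [dbl, giantStep, Rat.cast_add]
  rw [abs_le] at hk
  linarith [hk.2]

/-! ### Phase B: the greedy descent -/

/-- Before any level is processed the state is the unit ideal. [folklore] -/
theorem descentFrom_top (x : ℚ) (s₀ T : ℕ) : C.descentFrom x s₀ T T = (C.unit, 0) := by
  simp [descentFrom]

/-- Peeling the lowest processed level. [folklore] -/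
theorem descentFrom_pred (x : ℚ) (s₀ : ℕ) {T k : ℕ} (hk : k < T) :
    C.descentFrom x s₀ T k = C.descStep x s₀ (C.descentFrom x s₀ T (k + 1)) k := by
  unfold descentFrom
  have : List.range' k (T - k) = k :: List.range' (k + 1) (T - (k + 1)) := by
    rw [show T - k = (T - (k + 1)) + 1 by omega, List.range'_succ]
  rw [this, List.reverse_cons, List.foldl_append, List.foldl_cons, List.foldl_nil]

/-- Error after the levels `≥ k`: `Edesc k = ∑_{k ≤ i < T} (E_i + η)`. [folklore] -/
def Edesc (s₀ T k : ℕ) : ℝ := ∑ i ∈ Finset.Ico k T, (C.Edbl s₀ i + C.η)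

/-- `Edesc` is nonnegative. [folklore] -/
theorem Edesc_nonneg (s₀ T k : ℕ) : 0 ≤ C.Edesc s₀ T k :=
  Finset.sum_nonneg fun i _ => by have := C.Edbl_nonneg s₀ i; have := C.η_nonneg; linarith

/-- Peeling `Edesc`. [folklore] -/
theorem Edesc_pred {s₀ T k : ℕ} (hk : k < T) :
    C.Edesc s₀ T k = C.Edesc s₀ T (k + 1) + (C.Edbl s₀ k + C.η) := by
  unfold Edesc
  rw [Finset.sum_eq_sum_Ico_succ_bot hk]
  ring

/-- `Edesc … T = 0`. [folklore] -/
theorem Edesc_top (s₀ T : ℕ) : C.Edesc s₀ T T = 0 := by simp [Edesc]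

/-- **The descent states are approximate**: after the levels `≥ k`, within `Edesc k`.
[cite: Jozsa2003, §9 Thm. 5] -/
theorem approx_descentFrom (x : ℚ) (s₀ T : ℕ) :
    ∀ k, k ≤ T → C.Approx (C.descentFrom x s₀ T k) (C.Edesc s₀ T k) := by
  intro k hk
  induction' hT : T - k with j ih generalizing k
  · have : k = T := by omega
    subst this
    rw [descentFrom_top, Edesc_top]; exact C.approx_unit
  · have hkT : k < T := by omega
    rw [C.descentFrom_pred x s₀ hkT, C.Edesc_pred hkT]
    have ih' := ih (k + 1) (by omega) (by omega)
    unfold descStep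
    split_ifs
    · have := C.approx_giantStep ih' (C.approx_dbl s₀ k)
      exact this.mono (by linarith)
    · exact ih'.mono (by have := C.Edbl_nonneg s₀ k; have := C.η_nonneg; linarith)

/-- The descent never passes the target: `d̂ ≤ x` throughout (for `x ≥ 0`). [cite: Jozsa2003, §9 ("ensuring each time to stay to the left of x")] -/
theorem descentFrom_le {x : ℚ} (hx : 0 ≤ x) (s₀ T : ℕ) : ∀ k, k ≤ T → (C.descentFrom x s₀ T k).2 ≤ x := by
  intro k hk
  induction' hT : T - k with j ih generalizing k
  · have : k = T := by omega
    subst this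
    rw [descentFrom_top]; exact hx
  · have hkT : k < T := by omega
    rw [C.descentFrom_pred x s₀ hkT]
    have ih' := ih (k + 1) (by omega) (by omega)
    unfold descStep
    split_ifs with h
    · exact h
    · exact ih'

/-- **Residual of the descent**: after the levels `≥ k` (with `d̂(I_0) ≥ 2K + 1` and
`x ≤ d̂(I_{T})`… precisely `x ≤ d̂(I_k')` for the top level), the target is at most
`d̂(I_k) + (K + η) + (T − k)(2K + 2η)`… ahead. Stated for all `k ≤ T` given `x ≤ d̂(I_T) `:
`x − d̂(J_k) ≤ d̂(I_k) + (K + η) + (T − k) (2 (K + η))`. [cite: Jozsa2003, §9 (proof of Thm. 5: x − δ(J_*) ≤ A + ½ ln D)] -/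
theorem residual_descentFrom_le {x : ℚ} (s₀ : ℕ) {T : ℕ} (hxT : (x : ℝ) ≤ (C.dbl s₀ T).2) :
    ∀ k, k ≤ T → (x : ℝ) - (C.descentFrom x s₀ T k).2 ≤
      (C.dbl s₀ k).2 + (C.K + C.η) + ((T : ℝ) - k) * (2 * (C.K + C.η)) := by
  intro k hk
  have hKη : (0 : ℝ) ≤ C.K + C.η := by have := C.K_nonneg; have := C.η_nonneg; linarith
  induction' hT : T - k with j ih generalizing k
  · have : k = T := by omega
    subst this
    rw [descentFrom_top]
    simp only [Rat.cast_zero, sub_zero, sub_self, zero_mul, add_zero]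
    linarith
  · have hkT : k < T := by omega
    rw [C.descentFrom_pred x s₀ hkT]
    have ih' := ih (k + 1) (by omega) (by omega)
    have hsucc := C.dbl_succ_le s₀ k
    have hkh := C.abs_khat_le (C.descentFrom x s₀ T (k + 1)).1 (C.dbl s₀ k).1
    rw [abs_le] at hkh
    have hcast : ((T : ℝ) - (k + 1 : ℕ)) = (T : ℝ) - k - 1 := by push_cast; ring
    rw [hcast] at ih'
    unfold descStep
    split_ifs with h
    · -- accepted: the residual drops by `d̂(I_k) + khat`
      simp only [giantStep, Rat.cast_add]
      linarith [hkh.1, hkh.2, ih', hsucc]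
    · -- rejected: the candidate overshoots
      push Not at h
      have h' : (x : ℝ) < ((C.giantStep (C.descentFrom x s₀ T (k + 1)) (C.dbl s₀ k)).2 : ℝ) := by
        exact_mod_cast h
      simp only [giantStep, Rat.cast_add] at h'
      have hTk : (0 : ℝ) ≤ (T : ℝ) - k := by
        have : (k : ℝ) ≤ T := by exact_mod_cast hk
        linarith
      have hprod := mul_nonneg hTk hKη
      linarith [hkh.2, hprod]

/-- The residual bound of the full descent: `Res = d̂(I_0) + (K + η) + 2T(K + η)`.
[cite: Jozsa2003, §9 (proof of Thm. 5)] -/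
def Res (s₀ T : ℕ) : ℝ := ((C.start s₀).2 : ℝ) + (C.K + C.η) + (T : ℝ) * (2 * (C.K + C.η))

/-- `Res ≤ 2K + 1 + G + η + (K + η) + 2T(K + η)` — polynomial in `log Δ` and `T`. [folklore] -/
theorem Res_le (s₀ T : ℕ) :
    C.Res s₀ T ≤ 2 * C.K + 1 + (C.G + C.η) + (C.K + C.η) + (T : ℝ) * (2 * (C.K + C.η)) := by
  have := C.start_le s₀; unfold Res; linarith

/-- **The descent ends within `Res` of the target** (for `x ≤ d̂(I_T)`). [cite: Jozsa2003, §9 (proof of Thm. 5)] -/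
theorem residual_descent_le {x : ℚ} (s₀ : ℕ) {T : ℕ} (hxT : (x : ℝ) ≤ (C.dbl s₀ T).2) :
    (x : ℝ) - (C.descent x s₀ T).2 ≤ C.Res s₀ T := by
  have h := C.residual_descentFrom_le s₀ hxT 0 (Nat.zero_le T)
  simp only [Nat.cast_zero, sub_zero] at h
  exact h

/-! ### Phase C: the final baby steps -/

/-- A frozen state of the final walk stays put. [folklore] -/
theorem iterate_finStep_of_lt {x : ℚ} {J : St ι} (h : x < (C.babyStep J).2) (j : ℕ) :
    (C.finStep x)^[j] J = J := by
  induction j with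
  | zero => rfl
  | succ j ih => rw [Function.iterate_succ_apply', ih, finStep, if_neg (not_le.mpr h)]

/-- Before freezing, the final walk is plain iteration of `ρ`. [folklore] -/
theorem iterate_finStep_eq_of_le {x : ℚ} {J : St ι} :
    ∀ j, (C.babyStep ((C.finStep x)^[j] J)).2 ≤ x → (C.finStep x)^[j] J = (C.babyStep)^[j] J := by
  intro j
  induction j with
  | zero => intro; rfl
  | succ j ih =>
    intro hj
    -- the `j`-th iterate was not frozen either
    have hj' : (C.babyStep ((C.finStep x)^[j] J)).2 ≤ x := by
      by_contra hc
      push Not at hc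
      have hfix : (C.finStep x)^[j + 1] J = (C.finStep x)^[j] J := by
        rw [Function.iterate_succ_apply', finStep, if_neg (not_le.mpr hc)]
      rw [hfix] at hj
      exact absurd hj (not_le.mpr hc)
    rw [Function.iterate_succ_apply', ih hj', finStep, if_pos, Function.iterate_succ_apply']
    rwa [ih hj'] at hj'

/-- A final round costs at most `η`. [folklore] -/
theorem approx_finStep {x : ℚ} {J : St ι} {E : ℝ} (h : C.Approx J E) : C.Approx (C.finStep x J) (E + C.η) := by
  unfold finStep
  split_ifs
  · exact C.approx_babyStep h
  · exact h.mono (by have := C.η_nonneg; linarith)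

/-- Iterated rounds cost `j η`. [folklore] -/
theorem approx_iterate_finStep {x : ℚ} {J : St ι} {E : ℝ} (h : C.Approx J E) (j : ℕ) :
    C.Approx ((C.finStep x)^[j] J) (E + j * C.η) := by
  induction j with
  | zero => simpa using h
  | succ j ih =>
    rw [Function.iterate_succ_apply']
    have := C.approx_finStep (x := x) ih
    push_cast
    simpa [add_assoc, add_mul, one_mul] using this

/-- Iterated baby steps cost `j η`. [folklore] -/
theorem approx_iterate_babyStep {J : St ι} {E : ℝ} (h : C.Approx J E) (j : ℕ) :
    C.Approx ((C.babyStep)^[j] J) (E + j * C.η) := by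
  induction j with
  | zero => simpa using h
  | succ j ih =>
    rw [Function.iterate_succ_apply']
    have := C.approx_babyStep ih
    push_cast
    simpa [add_assoc, add_mul, one_mul] using this

/-- `2i` plain baby steps advance the computed distance by at least `i (L − 2η)`. [cite: Jozsa2003, Prop. 32] -/
theorem iterate_babyStep_ge {J : St ι} {E : ℝ} (h : C.Approx J E) (i : ℕ) :
    (J.2 : ℝ) + i * (C.L - 2 * C.η) ≤ (((C.babyStep)^[2 * i] J).2 : ℝ) := by
  induction i with
  | zero => simp
  | succ i ih =>
    have happ := C.approx_iterate_babyStep h (2 * i)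
    have h2 := C.two_babySteps_ge happ
    rw [show 2 * (i + 1) = (2 * i + 1) + 1 by ring, Function.iterate_succ_apply',
      Function.iterate_succ_apply']
    push_cast
    linarith

/-- The total error bound: `E_tot = Edesc 0 + (B + 1) η` — every state and every candidate the
walk ever compares with the target is `E_tot`-approximate. [cite: Jozsa2003, §9 Thm. 5] -/
def Etot (s₀ T B : ℕ) : ℝ := C.Edesc s₀ T 0 + ((B : ℝ) + 1) * C.η

/-- `E_tot ≤ (T 2^T (s₀ + 1) + T + B + 1) η` — so precision `η = 2^{-p}` with
`p = T + log₂(T (s₀ + 1) + B + 1) + m` gives `E_tot ≤ 2^{-m}`. [folklore] -/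
theorem Etot_le (s₀ T B : ℕ) :
    C.Etot s₀ T B ≤ ((T : ℝ) * 2 ^ T * ((s₀ : ℝ) + 1) + T + B + 1) * C.η := by
  have hη := C.η_nonneg
  unfold Etot Edesc
  have hterm : ∀ i ∈ Finset.Ico 0 T, C.Edbl s₀ i + C.η ≤ 2 ^ T * ((s₀ : ℝ) + 1) * C.η + C.η := by
    intro i hi
    rw [Finset.mem_Ico] at hi
    have h1 := C.Edbl_le s₀ i
    have h2 : (2 : ℝ) ^ i ≤ 2 ^ T := pow_le_pow_right₀ (by norm_num) hi.2.le
    have h3 : (0 : ℝ) ≤ ((s₀ : ℝ) + 1) * C.η := by positivity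
    nlinarith
  have hsum := Finset.sum_le_sum hterm
  rw [Finset.sum_const, Nat.card_Ico, Nat.sub_zero, nsmul_eq_mul] at hsum
  nlinarith

/-- `Edesc 0 ≤ E_tot` and room for one more `η`. [folklore] -/
theorem Edesc_add_le_Etot (s₀ T B : ℕ) {j : ℕ} (hj : j ≤ B) :
    C.Edesc s₀ T 0 + j * C.η + C.η ≤ C.Etot s₀ T B := by
  have hη := C.η_nonneg
  have : (j : ℝ) ≤ B := by exact_mod_cast hj
  unfold Etot; nlinarith

/-- **The final state is `E_tot`-approximate** (indeed `Edesc 0 + B η`). [cite: Jozsa2003, §9 Thm. 5] -/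
theorem approx_final (x : ℚ) (s₀ T B : ℕ) : C.Approx (C.final x s₀ T B) (C.Edesc s₀ T 0 + B * C.η) := by
  unfold final descent
  exact C.approx_iterate_finStep (C.approx_descentFrom x s₀ T 0 (Nat.zero_le T)) B

/-- **The walk stays at or to the left of the target** (`x ≥ 0`). [cite: Jozsa2003, §9 (proof of Thm. 5)] -/
theorem final_le {x : ℚ} (hx : 0 ≤ x) (s₀ T B : ℕ) : (C.final x s₀ T B).2 ≤ x := by
  unfold final
  induction B with
  | zero => simpa [descent] using C.descentFrom_le hx s₀ T 0 (Nat.zero_le T)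
  | succ B ih =>
    rw [Function.iterate_succ_apply']
    unfold finStep
    split_ifs with h
    · exact h
    · exact ih

/-- **The walk ends just left of the target**: with `x ≤ d̂(I_T)` and `B = 2M`,
`M (L − 2η) > Res`, the next baby step would pass `x`. (If no round froze, `2M` plain baby steps
would advance by more than the residual.) [cite: Jozsa2003, §9 (proof of Thm. 5: "I_x will certainly be either J' or ρ(J')")] -/
theorem lt_final_babyStep {x : ℚ} (hx : 0 ≤ x) (s₀ : ℕ) {T M : ℕ} (hxT : (x : ℝ) ≤ (C.dbl s₀ T).2)
    (hM : C.Res s₀ T < M * (C.L - 2 * C.η)) :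
    x < (C.babyStep (C.final x s₀ T (2 * M))).2 := by
  by_contra hcon
  push Not at hcon
  have heq := C.iterate_finStep_eq_of_le (x := x) (J := C.descent x s₀ T) (2 * M) hcon
  have hge := C.iterate_babyStep_ge (C.approx_descentFrom x s₀ T 0 (Nat.zero_le T)) M
  rw [← descent, ← heq] at hge
  have hle : (((C.finStep x)^[2 * M] (C.descent x s₀ T)).2 : ℝ) ≤ x := by
    exact_mod_cast C.final_le hx s₀ T (2 * M)
  have hres := C.residual_descent_le s₀ hxT
  linarith

/-! ### Canonicity: generic targets in one stretch give the same walk -/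

/-- Two targets take the same decisions on all `E`-approximate states. [folklore] -/
def Agree (x x' : ℚ) (E : ℝ) : Prop := ∀ s : St ι, C.Approx s E → (s.2 ≤ x ↔ s.2 ≤ x')

variable {C} in
/-- `Agree` is monotone (fewer states to agree on for smaller `E`). [folklore] -/
theorem Agree.mono {x x' : ℚ} {E E' : ℝ} (h : C.Agree x x' E) (hE : E' ≤ E) : C.Agree x x' E' :=
  fun s hs => h s (hs.mono hE)

/-- **Generic targets of one stretch agree**: if `x, x'` lie in the same stretch
`(P m, P (m+1))` and are farther than `E` from every true position, then every `E`-approximate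
state compares identically with `x` and `x'`. [cite: Jozsa2003, §10 Prop. 36 (iii) (the bad points are those next to an ideal)] -/
theorem agree_of_generic {x x' : ℚ} {E : ℝ} {m : ℤ}
    (hx : C.P m < x ∧ (x : ℝ) < C.P (m + 1)) (hx' : C.P m < x' ∧ (x' : ℝ) < C.P (m + 1))
    (gx : ∀ m', E < |(x : ℝ) - C.P m'|) (gx' : ∀ m', E < |(x' : ℝ) - C.P m'|) : C.Agree x x' E := by
  -- one direction suffices, by symmetry
  suffices key : ∀ (y y' : ℚ), (C.P m < y ∧ (y : ℝ) < C.P (m + 1)) → (C.P m < y' ∧ (y' : ℝ) < C.P (m + 1)) →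
      (∀ m', E < |(y : ℝ) - C.P m'|) → (∀ m', E < |(y' : ℝ) - C.P m'|) →
      ∀ s : St ι, C.Approx s E → s.2 ≤ y → s.2 ≤ y' by
    intro s hs
    exact ⟨key x x' hx hx' gx gx' s hs, key x' x hx' hx gx' gx s hs⟩
  intro y y' hy hy' gy gy' s hs hsy
  by_contra hc
  push Not at hc
  obtain ⟨m'', -, hd⟩ := hs
  rw [abs_le] at hd
  have hsy' : ((s.2 : ℚ) : ℝ) ≤ y := by exact_mod_cast hsy
  have hc' : ((y' : ℚ) : ℝ) < s.2 := by exact_mod_cast hc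
  -- `P m''` lies in `(y' - E, y + E]`
  have g1 := gy' m''
  have g2 := gy m''
  -- genericity of `y'` forces `P m'' > y' + E`, hence `m'' ≥ m + 1`
  have hP1 : (y' : ℝ) + E < C.P m'' := by
    rcases lt_or_ge ((y' : ℝ) - C.P m'') 0 with h | h
    · rw [abs_of_neg h] at g1; linarith
    · rw [abs_of_nonneg h] at g1; linarith [hd.1]
  have hm1 : m + 1 ≤ m'' := by
    by_contra h; push Not at h
    have := C.strictMono.monotone (show m'' ≤ m by omega)
    linarith [hy'.1]
  have hP2 : C.P (m + 1) ≤ C.P m'' := C.strictMono.monotone hm1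
  -- genericity of `y` forces `P m'' < y - E`, contradiction
  rcases lt_or_ge ((y : ℝ) - C.P m'') 0 with h | h
  · rw [abs_of_neg h] at g2; linarith [hd.2]
  · linarith [hy.2]

/-- Agreeing targets have the same descent. [folklore] -/
theorem descentFrom_eq_of_agree {x x' : ℚ} {s₀ T : ℕ} {E : ℝ} (h : C.Agree x x' E)
    (hE : C.Edesc s₀ T 0 ≤ E) : ∀ k, k ≤ T → C.descentFrom x s₀ T k = C.descentFrom x' s₀ T k := by
  intro k hk
  induction' hT : T - k with j ih generalizing k
  · have : k = T := by omega
    subst this; rw [descentFrom_top, descentFrom_top]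
  · have hkT : k < T := by omega
    rw [C.descentFrom_pred x s₀ hkT, C.descentFrom_pred x' s₀ hkT, ih (k + 1) (by omega) (by omega)]
    -- the common candidate is `Edesc k`-approximate
    have happ : C.Approx (C.giantStep (C.descentFrom x' s₀ T (k + 1)) (C.dbl s₀ k)) (C.Edesc s₀ T k) := by
      rw [C.Edesc_pred hkT]
      have := C.approx_giantStep (C.approx_descentFrom x' s₀ T (k + 1) (by omega)) (C.approx_dbl s₀ k)
      exact this.mono (by linarith)
    have hmono : C.Edesc s₀ T k ≤ C.Edesc s₀ T 0 := by
      unfold Edesc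
      apply Finset.sum_le_sum_of_subset_of_nonneg (Finset.Ico_subset_Ico (Nat.zero_le k) le_rfl)
      intro i _ _; have := C.Edbl_nonneg s₀ i; have := C.η_nonneg; linarith
    have hiff := h _ (happ.mono (hmono.trans hE))
    unfold descStep
    by_cases hc : (C.giantStep (C.descentFrom x' s₀ T (k + 1)) (C.dbl s₀ k)).2 ≤ x
    · rw [if_pos hc, if_pos (hiff.mp hc)]
    · rw [if_neg hc, if_neg (fun h' => hc (hiff.mpr h'))]

/-- **Agreeing targets have the same walk.** [cite: Jozsa2003, §9 Thm. 5 with §10 Prop. 36] -/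
theorem final_eq_of_agree {x x' : ℚ} {s₀ T B : ℕ} {E : ℝ} (h : C.Agree x x' E) (hE : C.Etot s₀ T B ≤ E) :
    C.final x s₀ T B = C.final x' s₀ T B := by
  have hη := C.η_nonneg
  have hdesc : C.descent x s₀ T = C.descent x' s₀ T :=
    C.descentFrom_eq_of_agree h ((by unfold Etot; nlinarith : C.Edesc s₀ T 0 ≤ C.Etot s₀ T B).trans hE)
      0 (Nat.zero_le T)
  unfold final
  rw [hdesc]
  -- the iterates agree as long as the candidates are `E`-approximate
  suffices H : ∀ j, j ≤ B → (C.finStep x)^[j] (C.descent x' s₀ T) = (C.finStep x')^[j] (C.descent x' s₀ T) from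
    H B le_rfl
  intro j hj
  induction j with
  | zero => rfl
  | succ j ih =>
    rw [Function.iterate_succ_apply', Function.iterate_succ_apply', ih (by omega)]
    set J := (C.finStep x')^[j] (C.descent x' s₀ T)
    have happJ : C.Approx J (C.Edesc s₀ T 0 + j * C.η) :=
      C.approx_iterate_finStep (C.approx_descentFrom x' s₀ T 0 (Nat.zero_le T)) j
    have happ : C.Approx (C.babyStep J) (C.Etot s₀ T B) :=
      (C.approx_babyStep happJ).mono (C.Edesc_add_le_Etot s₀ T B (by omega))
    have hiff := h _ (happ.mono hE)
    unfold finStep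
    by_cases hc : (C.babyStep J).2 ≤ x
    · rw [if_pos hc, if_pos (hiff.mp hc)]
    · rw [if_neg hc, if_neg (fun h' => hc (hiff.mpr h'))]

/-- **Generic targets of one stretch give the same final state.** [cite: Jozsa2003, §9 Thm. 5 with §10 Prop. 36] -/
theorem final_eq_of_generic {x x' : ℚ} {s₀ T B : ℕ} {m : ℤ}
    (hx : C.P m < x ∧ (x : ℝ) < C.P (m + 1)) (hx' : C.P m < x' ∧ (x' : ℝ) < C.P (m + 1))
    (gx : ∀ m', C.Etot s₀ T B < |(x : ℝ) - C.P m'|) (gx' : ∀ m', C.Etot s₀ T B < |(x' : ℝ) - C.P m'|) :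
    C.final x s₀ T B = C.final x' s₀ T B :=
  C.final_eq_of_agree (C.agree_of_generic hx hx' gx gx') le_rfl

/-! ### Correctness at generic targets -/

/-- **At a generic target the walk ends at the ideal to the left of `x`, with the distance of
that very copy**: if `x` is farther than `E_tot` from every true position and the parameters are
adequate (`d̂(I_0) ≥ 2K + 1` is automatic in `Res`; `x ≤ d̂(I_T)`; `B = 2M`, `M(L − 2η) > Res`),
then the final label is `lab m` for the stretch `(P m, P (m+1)) ∋ x` and `|d̂ − P m| ≤ E_tot`.
[cite: Jozsa2003, §9 Thm. 5 ("we can compute the ideal I_x exactly and an approximation of x̃ − δ(I_x)")] -/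
theorem final_correct {x : ℚ} (hx0 : 0 ≤ x) {s₀ T M : ℕ} {m : ℤ}
    (hxT : (x : ℝ) ≤ (C.dbl s₀ T).2) (hM : C.Res s₀ T < M * (C.L - 2 * C.η))
    (hm : C.P m < x ∧ (x : ℝ) < C.P (m + 1)) (gx : ∀ m', C.Etot s₀ T (2 * M) < |(x : ℝ) - C.P m'|) :
    (C.final x s₀ T (2 * M)).1 = C.lab m ∧
      |((C.final x s₀ T (2 * M)).2 : ℝ) - C.P m| ≤ C.Etot s₀ T (2 * M) := by
  have hle : ((C.final x s₀ T (2 * M)).2 : ℝ) ≤ x := by exact_mod_cast C.final_le hx0 s₀ T (2 * M)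
  have hlt : (x : ℝ) < (C.babyStep (C.final x s₀ T (2 * M))).2 := by
    exact_mod_cast C.lt_final_babyStep hx0 s₀ hxT hM
  obtain ⟨m', hm', hd⟩ := C.approx_final x s₀ T (2 * M)
  have hEt : C.Edesc s₀ T 0 + (2 * M : ℕ) * C.η + C.η ≤ C.Etot s₀ T (2 * M) :=
    C.Edesc_add_le_Etot s₀ T (2 * M) le_rfl
  have hη := C.η_nonneg
  -- the next position is within `E_tot` of `d̂(ρ J)`
  have hg := C.ghat_spec m'
  rw [hm'] at hg
  have hb : ((C.babyStep (C.final x s₀ T (2 * M))).2 : ℝ) =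
      (C.final x s₀ T (2 * M)).2 + C.ghat (C.final x s₀ T (2 * M)).1 := by simp [babyStep]
  rw [hb] at hlt
  push_cast at hd hEt
  rw [abs_le] at hd hg
  -- `P m' < x < P (m' + 1)`
  have g1 := gx m'
  have g2 := gx (m' + 1)
  have hP1 : C.P m' < x := by
    rcases lt_or_ge ((x : ℝ) - C.P m') 0 with h | h
    · rw [abs_of_neg h] at g1; linarith [hd.1]
    · rw [abs_of_nonneg h] at g1; linarith
  have hP2 : (x : ℝ) < C.P (m' + 1) := by
    rcases lt_or_ge ((x : ℝ) - C.P (m' + 1)) 0 with h | h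
    · linarith
    · rw [abs_of_nonneg h] at g2; linarith [hd.2, hg.2]
  -- hence `m' = m`
  have hmm : m' = m := by
    by_contra hne
    rcases lt_or_gt_of_ne hne with h | h
    · have := C.strictMono.monotone (show m' + 1 ≤ m by omega); linarith [hm.1]
    · have := C.strictMono.monotone (show m + 1 ≤ m' by omega); linarith [hm.2]
  subst hmm
  refine ⟨hm'.symm, ?_⟩
  rw [abs_le]
  constructor <;> linarith [hd.1, hd.2]

/-! ### The table of the walk -/

/-- **Blur**: every table value has the shape `(lab m, v − c)` with an integer anchor `c` within
`N E + 1` of `N · P m`, `E = Edesc 0 + B η`. [cite: Jozsa2003, §10 Prop. 36] -/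
theorem table_blur (N s₀ T B : ℕ) (v : ℤ) :
    ∃ m c : ℤ, |(c : ℝ) - N * C.P m| ≤ N * (C.Edesc s₀ T 0 + B * C.η) + 1 ∧
      C.table N s₀ T B v = (C.lab m, v - c) := by
  obtain ⟨m, hm, hd⟩ := C.approx_final ((v : ℚ) / N) s₀ T B
  set J := C.final ((v : ℚ) / N) s₀ T B with hJ
  refine ⟨m, ⌈(N : ℚ) * J.2⌉, ?_, by rw [table, ← hJ, hm]⟩
  have hceil := Int.ceil_lt_add_one ((N : ℚ) * J.2)
  have hceil' := Int.le_ceil ((N : ℚ) * J.2)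
  have h1 : ((⌈(N : ℚ) * J.2⌉ : ℤ) : ℝ) < N * (J.2 : ℝ) + 1 := by
    have : ((⌈(N : ℚ) * J.2⌉ : ℚ) : ℝ) < (((N : ℚ) * J.2 + 1 : ℚ) : ℝ) := by exact_mod_cast hceil
    push_cast at this; exact this
  have h2 : (N : ℝ) * (J.2 : ℝ) ≤ ((⌈(N : ℚ) * J.2⌉ : ℤ) : ℝ) := by
    have : (((N : ℚ) * J.2 : ℚ) : ℝ) ≤ ((⌈(N : ℚ) * J.2⌉ : ℚ) : ℝ) := by exact_mod_cast hceil'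
    push_cast at this; exact this
  have hN : (0 : ℝ) ≤ N := by positivity
  rw [abs_le] at hd ⊢
  have hlo := mul_le_mul_of_nonneg_left hd.1 hN
  have hhi := mul_le_mul_of_nonneg_left hd.2 hN
  constructor <;> nlinarith

/-- **Exactness at generic grid points**: if `v` is farther than `N E_tot` from every scaled
position and lies in the scaled stretch `(N P m, N P (m+1))`, then the table value at `v` is
`(lab m, v − ⌈N d̂⌉)` with `|d̂ − P m| ≤ E_tot`, and the walk (hence the anchor `⌈N d̂⌉`) is the same
for all such `v` of the stretch. [cite: Jozsa2003, §9 Thm. 5, §10 Prop. 36] -/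
theorem table_exact {N : ℕ} (hN : 0 < N) {s₀ T M : ℕ} {m : ℤ} {v : ℤ} (hv0 : 0 ≤ v)
    (hxT : ((v : ℝ) / N) ≤ (C.dbl s₀ T).2) (hM : C.Res s₀ T < M * (C.L - 2 * C.η))
    (hm : (N : ℝ) * C.P m < v ∧ (v : ℝ) < N * C.P (m + 1))
    (gv : ∀ m', (N : ℝ) * C.Etot s₀ T (2 * M) < |(v : ℝ) - N * C.P m'|) :
    (C.final ((v : ℚ) / N) s₀ T (2 * M)).1 = C.lab m ∧
      |((C.final ((v : ℚ) / N) s₀ T (2 * M)).2 : ℝ) - C.P m| ≤ C.Etot s₀ T (2 * M) := by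
  have hNr : (0 : ℝ) < N := by exact_mod_cast hN
  have hcast : (((v : ℚ) / N : ℚ) : ℝ) = (v : ℝ) / N := by push_cast; rfl
  apply C.final_correct (by positivity) (by rwa [hcast]) hM
  · rw [hcast]
    constructor
    · rw [lt_div_iff₀ hNr]; linarith [hm.1]
    · rw [div_lt_iff₀ hNr]; linarith [hm.2]
  · intro m'
    rw [hcast]
    have h := gv m'
    have : (v : ℝ) / N - C.P m' = ((v : ℝ) - N * C.P m') / N := by field_simp
    rw [this, abs_div, abs_of_pos hNr, lt_div_iff₀ hNr]
    linarith

/-- **Canonicity on the grid**: two generic grid points of one scaled stretch have the same walk.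
[cite: Jozsa2003, §9 Thm. 5 with §10 Prop. 36] -/
theorem final_eq_of_generic_grid {N : ℕ} (hN : 0 < N) {s₀ T B : ℕ} {m : ℤ} {v v' : ℤ}
    (hm : (N : ℝ) * C.P m < v ∧ (v : ℝ) < N * C.P (m + 1))
    (hm' : (N : ℝ) * C.P m < v' ∧ (v' : ℝ) < N * C.P (m + 1))
    (gv : ∀ m', (N : ℝ) * C.Etot s₀ T B < |(v : ℝ) - N * C.P m'|)
    (gv' : ∀ m', (N : ℝ) * C.Etot s₀ T B < |(v' : ℝ) - N * C.P m'|) :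
    C.final ((v : ℚ) / N) s₀ T B = C.final ((v' : ℚ) / N) s₀ T B := by
  have hNr : (0 : ℝ) < N := by exact_mod_cast hN
  have hcast : ∀ w : ℤ, (((w : ℚ) / N : ℚ) : ℝ) = (w : ℝ) / N := fun w => by push_cast; rfl
  have hin : ∀ w : ℤ, ((N : ℝ) * C.P m < w ∧ (w : ℝ) < N * C.P (m + 1)) →
      (C.P m < ((w : ℚ) / N : ℚ) ∧ ((((w : ℚ) / N : ℚ)) : ℝ) < C.P (m + 1)) := by
    intro w hw
    rw [hcast]
    exact ⟨by rw [lt_div_iff₀ hNr]; linarith [hw.1], by rw [div_lt_iff₀ hNr]; linarith [hw.2]⟩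
  have hgen : ∀ w : ℤ, (∀ m', (N : ℝ) * C.Etot s₀ T B < |(w : ℝ) - N * C.P m'|) →
      ∀ m', C.Etot s₀ T B < |((((w : ℚ) / N : ℚ)) : ℝ) - C.P m'| := by
    intro w hw m'
    rw [hcast]
    have h := hw m'
    have : (w : ℝ) / N - C.P m' = ((w : ℝ) - N * C.P m') / N := by field_simp
    rw [this, abs_div, abs_of_pos hNr, lt_div_iff₀ hNr]
    linarith
  exact C.final_eq_of_generic (hin v hm) (hin v' hm') (hgen v gv) (hgen v' gv')

/-! ### Adequate parameters -/

/-- **Adequate doubling depth**: `x ≤ d̂(I_T)` as soon as `x + K ≤ 2^T · 7/8` (given the start-up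
froze, `d̂(I_0) ≥ 2K + 1`). [cite: Jozsa2003, §9 (proof of Thm. 5: "N < ⌈log₂(x/A)⌉")] -/
theorem le_dbl_of_le_two_pow {s₀ : ℕ} (h0 : 2 * C.K + 1 ≤ (C.start s₀).2) {T : ℕ} {x : ℝ}
    (hx : x ≤ (2 : ℝ) ^ T * (7 / 8)) : x ≤ (C.dbl s₀ T).2 := by
  have := C.dbl_ge h0 T
  have := C.K_nonneg
  linarith

end GiantStepCycle

end Literature.Computability.Cryptography

end
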